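import Literature.Combinatorics.Optimization.ApproximateIdentityPsdRank
import Literature.Combinatorics.Optimization.PsdRankComparisons
import Mathlib.Analysis.Complex.ExponentialBounds
import Mathlib.Data.Nat.Choose.Bounds
import HarnessLib

/-!
# Perturbed identity matrices have high rank (Alon 2009, Theorems 1.1 / 2.1), and the psd-rank
# consequence (Lee–Wei–de Wolf 2017, Theorems 48–49) — PROVED

Sources. N. Alon, *Perturbed identity matrices have high rank: proof and applications*, Combin.
Probab. Comput. 18 (2009) 3–15 [Alon2009] (held text `paper:doi-10-1017-s0963548307008917`, p01–p03);
T. Lee, Z. Wei, R. de Wolf, *Some upper and lower bounds on PSD-rank*, Math. Program. 162 (2017) =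
arXiv:1407.4308 [LeeWeiDeWolf2017] (held text `paper:arxiv-1407.4308`, p14).

Printed statements (verbatim). [Alon2009, p01] "**Theorem 1.1** There exists an absolute positive
constant `c` so that the following holds. Let `B` be an `n` by `n` real matrix with `b_{i,i} ≥ 1/2` for
all `i` and `|b_{i,j}| ≤ ε` for all `i ≠ j`, where `1/(2√n) ≤ ε < 1/4`. Then the rank of `B` satisfies
`rank(B) ≥ c log n / (ε² log(1/ε))`." [Alon2009, p02] "**Theorem 2.1** There exists an absolute positive
constant `c` so that the following holds. Let `B` be an `n` by `n` real matrix with `b_{i,i} = 1` for all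
`i` and `|b_{i,j}| ≤ ε` for all `i ≠ j`. If the rank of `B` is `d`, and `1/√n ≤ ε < 1/2`, then
`d ≥ c log n/(ε² log(1/ε))`." "**Lemma 2.2** Let `A = (a_{i,j})` be an `n` by `n` real, symmetric matrix
with `a_{i,i} = 1` for all `i` and `|a_{i,j}| ≤ ε` for all `i ≠ j`. If the rank of `A` is `d`, then
`d ≥ n/(1 + (n−1)ε²)`." "**Lemma 2.3** Let `B = (b_{i,j})` be an `n` by `n` matrix of rank `d`, and let
`P(x)` be an arbitrary polynomial of degree `k`. Then the rank of the `n` by `n` matrix `(P(b_{i,j}))` is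
at most `C(k+d, k)`." Proof of Theorem 2.1 (p03): "If `ε ≤ 1/n^δ` for some fixed `δ > 0`, the result
follows by applying Lemma 2.2 to a `⌊1/ε²⌋` by `⌊1/ε²⌋` submatrix of `B`. Thus we may assume that
`ε ≥ 1/n^δ` … Put `k = ⌊log n/(2 log(1/ε))⌋`, `n₀ = ⌊1/ε^{2k}⌋` and note that `n₀ ≤ n` and that
`ε^k ≤ 1/√n₀`. By Lemma 2.3 the rank of the `n₀` by `n₀` matrix `(b^k_{i,j})_{i,j ≤ n₀}` is at most
`C(d+k,k) ≤ (e(k+d)/k)^k`. On the other hand, by Lemma 2.2, the rank of this matrix is at least `n₀/2`.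
Therefore `(e(k+d)/k)^k ≥ n₀/2`, and the desired result follows by some simple manipulation".
Proof of Theorem 1.1 (p03): "Let `C` be the diagonal matrix `c_{i,i} = 1/b_{i,i}`. Then every diagonal
entry of `CB` is `1` and every off-diagonal entry is of absolute value at most `2ε`."
[LeeWeiDeWolf2017, p14] "**Theorem 48** ([Alo09]) There exists an absolute positive constant `c` so that
the following holds. Let `A` be an `n`-by-`n` real matrix with `|a(i,i)| ≥ 1/2` for all `i` and
`|a(i,j)| ≤ ε` for any `i ≠ j`, where `1/(2√n) ≤ ε ≤ 1/4`. Then `rank(A) ≥ c log n/(ε² log(1/ε))`.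
**Theorem 49** Assume the condition is the same as the above, then
`rank_psd(A) ≥ c √(log n)/(ε √(log(1/ε)))`."

What is typed and how. Lemma 2.2 is the tree's `LeeWeiDeWolf2017_rank_approxIdentity` (for any real
matrix, through `|tr A|² ≤ rank A · Σ a_{ij}²`, so the symmetrisation step of the printed proof is not
needed); Lemma 2.3 for `P = x^k` is the tree's Barvinok bound `FawziEtAl2015_lemma54_holds`. The
"simple manipulation" the source omits is carried out with explicit constants: with `L = log n`,
`λ = log(1/ε)`, `x = 1/ε²`, either `λ ≥ L/16` (then the `⌊x⌋ × ⌊x⌋` principal submatrix gives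
`d ≥ 3x/8 ≥ (3/128)·Lx/λ`) or `k = ⌊L/(4λ)⌋ ≥ 4`, `m = ⌊x^k⌋ ≤ √n`, the `k`-th Hadamard power of the
`m × m` principal submatrix has rank `≥ x^k/4` and `≤ C(d+k,k) ≤ (e(d+k)/k)^k`, whence `d ≥ kx/128 ≥
(3/2048)·Lx/λ`. The theorems are stated with the explicit absolute constant `c = 3/2048` (Theorem 2.1,
valid for `ε ≤ 1/2`), `3/8192` (Theorem 1.1 / LWdW Theorem 48) and `√(3/8192)` (LWdW Theorem 49), and
in the printed `∃ c > 0` form.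

* `Alon2009_thm21_explicit`, **`Alon2009_thm21`**; `Alon2009_thm11_explicit`, **`Alon2009_thm11`** =
  **`LeeWeiDeWolf2017_thm48`** (diagonal `|b_{ii}| ≥ 1/2`, `1/(2√n) ≤ ε ≤ 1/4`);
  **`LeeWeiDeWolf2017_thm49`** (every complex psd factorization of such a matrix has size
  `r ≥ c√(log n)/(ε√(log(1/ε)))`, via Fact 4 `rank ≤ r²`, the tree's `HasComplexPsdFactorization.rank_le_sq`).
* Appended: **`Alon2009_lemma23_hadamardPow`** — Lemma 2.3, second statement: `rank((b_{ij}^k)) ≤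
  C(k + rank B − 1, k)` for any real matrix (the first statement is the tree's Barvinok bound).
-/

open Matrix Finset

namespace Literature.Combinatorics.Optimization

section Alon

/-- `C(d+k, k) ≤ (e(d+k)/k)^k` for `k ≥ 1` (`C(N,k) ≤ N^k/k!` and `k^k/k! ≤ e^k`). [folklore] -/
private theorem choose_le_exp_mul_pow (d k : ℕ) (hk : 1 ≤ k) :
    ((d + k).choose k : ℝ) ≤ (Real.exp 1 * (d + k) / k) ^ k := by
  have hk0 : (0 : ℝ) < k := by exact_mod_cast hk
  have h1 : ((d + k).choose k : ℝ) ≤ ((d + k : ℕ) : ℝ) ^ k / (Nat.factorial k) :=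
    Nat.choose_le_pow_div k (d + k)
  have h2 : (k : ℝ) ^ k / (Nat.factorial k) ≤ Real.exp k := Real.pow_div_factorial_le_exp (k : ℝ) hk0.le k
  have hfac : (0 : ℝ) < Nat.factorial k := by exact_mod_cast Nat.factorial_pos k
  have h3 : Real.exp (k : ℝ) = Real.exp 1 ^ k := by rw [← Real.exp_one_pow]
  calc ((d + k).choose k : ℝ) ≤ ((d + k : ℕ) : ℝ) ^ k / (Nat.factorial k) := h1
    _ = (((d : ℝ) + k) / k) ^ k * ((k : ℝ) ^ k / (Nat.factorial k)) := by
        push_cast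
        field_simp
        rw [← mul_pow, div_mul_cancel₀ _ hk0.ne']
    _ ≤ (((d : ℝ) + k) / k) ^ k * Real.exp 1 ^ k :=
        mul_le_mul_of_nonneg_left (h3 ▸ h2) (by positivity)
    _ = (Real.exp 1 * (d + k) / k) ^ k := by rw [← mul_pow]; ring

/-- Lemma 2.2 on a principal submatrix: if `B` has unit diagonal and off-diagonal entries of modulus
`≤ δ`, then for `m ≤ n` indices and the `k`-th Hadamard power, `m ≤ rank((b^k)_{m×m})(1 + δ^{2k}(m−1))`
and `rank((b^k)_{m×m}) ≤ C(k + rank B, k)`. [cite: Alon2009, Lemma 2.2 and Lemma 2.3 (p02)] -/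
theorem Alon2009_hadamardPow_submatrix {n m k : ℕ} (hmn : m ≤ n)
    {B : Matrix (Fin n) (Fin n) ℝ} {δ : ℝ} (hdiag : ∀ i, B i i = 1) (hoff : ∀ i j, i ≠ j → |B i j| ≤ δ) :
    (m : ℝ) ≤ (Matrix.of fun i j : Fin m => B (Fin.castLE hmn i) (Fin.castLE hmn j) ^ k).rank *
        (1 + (δ ^ k) ^ 2 * (m - 1)) ∧
      (Matrix.of fun i j : Fin m => B (Fin.castLE hmn i) (Fin.castLE hmn j) ^ k).rank ≤
        (k + B.rank).choose k := by
  classical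
  set B' : Matrix (Fin m) (Fin m) ℝ := B.submatrix (Fin.castLE hmn) (Fin.castLE hmn) with hB'
  have hinj : Function.Injective (Fin.castLE hmn) := Fin.castLE_injective hmn
  constructor
  · refine LeeWeiDeWolf2017_rank_approxIdentity (fun i => by simp [hdiag]) fun i j hij => ?_
    simp only [Matrix.of_apply, abs_pow]
    have hne : Fin.castLE hmn i ≠ Fin.castLE hmn j := fun h => hij (hinj h)
    exact pow_le_pow_left₀ (abs_nonneg _) (hoff _ _ hne) k
  · have h54 := FawziEtAl2015_lemma54_holds (Fin m) (Fin m) B' (Polynomial.X ^ k) k (by simp)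
    simp only [Polynomial.eval_pow, Polynomial.eval_X, hB', Matrix.submatrix_apply] at h54
    refine h54.trans (Nat.choose_le_choose k (Nat.add_le_add_left ?_ k))
    exact Matrix.rank_submatrix_le B _ _

/-- The first step of the printed proof ("applying Lemma 2.2 to a `⌊1/ε²⌋` by `⌊1/ε²⌋` submatrix"),
valid throughout: `rank B ≥ (3/8)·(1/ε²)` whenever `1/√n ≤ ε ≤ 1/2`.
[cite: Alon2009, Thm. 2.1 proof (p03)] -/
theorem Alon2009_rank_ge_inv_sq {n : ℕ} (hn : 1 ≤ n) {B : Matrix (Fin n) (Fin n) ℝ} {ε : ℝ}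
    (hdiag : ∀ i, B i i = 1) (hoff : ∀ i j, i ≠ j → |B i j| ≤ ε)
    (hε1 : 1 / Real.sqrt n ≤ ε) (hε2 : ε ≤ 1 / 2) : 3 / 8 * (1 / ε ^ 2) ≤ B.rank := by
  classical
  have hn0 : (0 : ℝ) < n := by exact_mod_cast hn
  have hεpos : 0 < ε := lt_of_lt_of_le (by positivity) hε1
  set x : ℝ := 1 / ε ^ 2 with hx
  have hx4 : 4 ≤ x := by
    rw [hx, le_div_iff₀ (by positivity)]; nlinarith
  have hxn : x ≤ n := by
    -- `1/√n ≤ ε` gives `1/n ≤ ε²`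
    have h1 : 1 / (n : ℝ) ≤ ε ^ 2 := by
      have h := pow_le_pow_left₀ (by positivity) hε1 2
      rwa [div_pow, one_pow, Real.sq_sqrt hn0.le] at h
    rw [hx, div_le_iff₀ (by positivity)]
    rw [div_le_iff₀ hn0] at h1
    linarith
  set m : ℕ := ⌊x⌋₊ with hm
  have hmx : (m : ℝ) ≤ x := Nat.floor_le (by positivity)
  have hmx' : x - 1 ≤ m := by have := Nat.lt_floor_add_one x; linarith
  have hmn : m ≤ n := (Nat.floor_le_floor hxn).trans (Nat.floor_natCast n).le
  -- Lemma 2.2 on the `m × m` principal submatrix (Hadamard power `1`)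
  obtain ⟨h22, _⟩ := Alon2009_hadamardPow_submatrix (k := 1) hmn hdiag hoff
  simp only [pow_one] at h22
  have hrk : (Matrix.of fun i j : Fin m => B (Fin.castLE hmn i) (Fin.castLE hmn j)).rank ≤ B.rank :=
    Matrix.rank_submatrix_le B _ _
  have hrk' : ((Matrix.of fun i j : Fin m => B (Fin.castLE hmn i) (Fin.castLE hmn j)).rank : ℝ) ≤ B.rank := by
    exact_mod_cast hrk
  -- `1 + ε²(m−1) ≤ 2`
  have hfac : 1 + ε ^ 2 * ((m : ℝ) - 1) ≤ 2 := by
    have : ε ^ 2 * ((m : ℝ) - 1) ≤ ε ^ 2 * x := mul_le_mul_of_nonneg_left (by linarith) (by positivity)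
    have hx1 : ε ^ 2 * x = 1 := by rw [hx]; field_simp
    linarith
  have hd0 : (0 : ℝ) ≤ B.rank := Nat.cast_nonneg _
  have h2 : (m : ℝ) ≤ B.rank * 2 := by
    calc (m : ℝ) ≤ _ := h22
      _ ≤ B.rank * (1 + ε ^ 2 * ((m : ℝ) - 1)) :=
          mul_le_mul_of_nonneg_right hrk' (by
            have := h22; nlinarith [Nat.cast_nonneg (α := ℝ) m, hmx', hx4])
      _ ≤ B.rank * 2 := mul_le_mul_of_nonneg_left hfac hd0
  nlinarith

/-- **Alon's Theorem 2.1 with an explicit constant** (`c = 3/2048`, and `ε ≤ 1/2` allowed): for a real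
`n × n` matrix with unit diagonal and off-diagonal entries of modulus `≤ ε`, `1/√n ≤ ε ≤ 1/2`,
`rank(B) ≥ (3/2048)·log n/(ε² log(1/ε))`. The printed proof with the omitted "simple manipulation"
made explicit (see the module docstring). [cite: Alon2009, Thm. 2.1 (p02–p03)] -/
theorem Alon2009_thm21_explicit {n : ℕ} {B : Matrix (Fin n) (Fin n) ℝ} {ε : ℝ}
    (hdiag : ∀ i, B i i = 1) (hoff : ∀ i j, i ≠ j → |B i j| ≤ ε)
    (hε1 : 1 / Real.sqrt n ≤ ε) (hε2 : ε ≤ 1 / 2) :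
    3 / 2048 * Real.log n / (ε ^ 2 * Real.log (1 / ε)) ≤ B.rank := by
  classical
  rcases Nat.eq_zero_or_pos n with hn | hn
  · subst hn; simp
  have hn0 : (0 : ℝ) < n := by exact_mod_cast hn
  have hεpos : 0 < ε := lt_of_lt_of_le (by positivity) hε1
  set x : ℝ := 1 / ε ^ 2 with hx
  have hx4 : 4 ≤ x := by
    rw [hx, le_div_iff₀ (by positivity)]; nlinarith
  have hxpos : 0 < x := by linarith
  have hxn : x ≤ n := by
    have h1 : 1 / (n : ℝ) ≤ ε ^ 2 := by
      have h := pow_le_pow_left₀ (by positivity) hε1 2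
      rwa [div_pow, one_pow, Real.sq_sqrt hn0.le] at h
    rw [hx, div_le_iff₀ (by positivity)]
    rw [div_le_iff₀ hn0] at h1
    linarith
  set L : ℝ := Real.log n with hL
  set lam : ℝ := Real.log (1 / ε) with hlam
  have hL0 : 0 ≤ L := Real.log_nonneg (by exact_mod_cast hn)
  have hlam0 : 0 < lam := Real.log_pos (by rw [lt_div_iff₀ hεpos]; linarith)
  have hlogx : Real.log x = 2 * lam := by
    rw [hx, hlam, one_div, Real.log_inv, one_div, Real.log_inv, Real.log_pow]; push_cast; ring
  set d : ℕ := B.rank with hd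
  have hd0 : (0 : ℝ) ≤ d := Nat.cast_nonneg _
  -- the bound to prove, rewritten: `(3/2048) · (L/lam) · x ≤ d`
  have hgoal : 3 / 2048 * L / (ε ^ 2 * lam) = 3 / 2048 * (L / lam) * x := by
    rw [hx]; field_simp
  rw [hgoal]
  have hA : 3 / 8 * x ≤ d := by
    have := Alon2009_rank_ge_inv_sq hn hdiag hoff hε1 hε2
    simpa [hx] using this
  by_cases hcase : L ≤ 16 * lam
  · -- Case A: `L/lam ≤ 16`
    have h1 : L / lam ≤ 16 := by rw [div_le_iff₀ hlam0]; linarith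
    calc 3 / 2048 * (L / lam) * x ≤ 3 / 2048 * 16 * x :=
          mul_le_mul_of_nonneg_right (mul_le_mul_of_nonneg_left h1 (by norm_num)) hxpos.le
      _ ≤ d := by linarith
  · -- Case B: Hadamard powers
    push Not at hcase
    set t : ℝ := L / (4 * lam) with ht
    have ht4 : 4 < t := by rw [ht, lt_div_iff₀ (by positivity)]; linarith
    set k : ℕ := ⌊t⌋₊ with hk
    have hkt : (k : ℝ) ≤ t := Nat.floor_le (by linarith)
    have hkt' : t - 1 < k := by have := Nat.lt_floor_add_one t; linarith
    have hk4 : 4 ≤ k := by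
      have : (4 : ℝ) ≤ ⌊t⌋₊ := by
        have h := Nat.le_floor (α := ℝ) (n := 4) (a := t) (by exact_mod_cast ht4.le)
        exact_mod_cast h
      exact_mod_cast this
    have hk1 : 1 ≤ k := le_trans (by norm_num) hk4
    have hk0 : (0 : ℝ) < k := by exact_mod_cast hk1
    -- `x^k ≤ n`
    have hxk_n : x ^ k ≤ (n : ℝ) := by
      rw [← Real.log_le_log_iff (by positivity) hn0, Real.log_pow, hlogx]
      have : (k : ℝ) * (2 * lam) ≤ t * (2 * lam) := mul_le_mul_of_nonneg_right hkt (by positivity)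
      have ht2 : t * (2 * lam) = L / 2 := by rw [ht]; field_simp; ring
      linarith
    have hxk4 : 4 ≤ x ^ k := le_trans hx4 (le_self_pow₀ (by linarith) (by omega))
    set m : ℕ := ⌊x ^ k⌋₊ with hm
    have hmx : (m : ℝ) ≤ x ^ k := Nat.floor_le (by positivity)
    have hmx' : x ^ k - 1 ≤ m := by have := Nat.lt_floor_add_one (x ^ k); linarith
    have hmn : m ≤ n := (Nat.floor_le_floor hxk_n).trans (Nat.floor_natCast n).le
    obtain ⟨h22, h23⟩ := Alon2009_hadamardPow_submatrix (k := k) hmn hdiag hoff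
    set R : ℕ := (Matrix.of fun i j : Fin m => B (Fin.castLE hmn i) (Fin.castLE hmn j) ^ k).rank with hR
    -- `rank H ≥ x^k/4`
    have hfac : 1 + (ε ^ k) ^ 2 * ((m : ℝ) - 1) ≤ 2 := by
      have h1 : (ε ^ k) ^ 2 * ((m : ℝ) - 1) ≤ (ε ^ k) ^ 2 * x ^ k :=
        mul_le_mul_of_nonneg_left (by linarith) (by positivity)
      have h2 : (ε ^ k) ^ 2 * x ^ k = 1 := by
        rw [← pow_mul, mul_comm k 2, pow_mul, ← mul_pow, hx]
        rw [show ε ^ 2 * (1 / ε ^ 2) = 1 by field_simp, one_pow]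
      linarith
    have hR0 : (0 : ℝ) ≤ R := Nat.cast_nonneg _
    have hRge : x ^ k / 4 ≤ R := by
      have h2 : (m : ℝ) ≤ R * 2 := by
        calc (m : ℝ) ≤ R * (1 + (ε ^ k) ^ 2 * ((m : ℝ) - 1)) := h22
          _ ≤ R * 2 := mul_le_mul_of_nonneg_left hfac hR0
      rw [div_le_iff₀ (by norm_num)]
      linarith
    -- `rank H ≤ C(d+k,k) ≤ (e(d+k)/k)^k`
    have hRle : (R : ℝ) ≤ (Real.exp 1 * (d + k) / k) ^ k := by
      have h1 : (R : ℝ) ≤ ((k + d).choose k : ℕ) := by exact_mod_cast h23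
      rw [add_comm] at h1
      exact h1.trans (choose_le_exp_mul_pow d k hk1)
    have hstar : x ^ k / 4 ≤ (Real.exp 1 * (d + k) / k) ^ k := hRge.trans hRle
    -- the manipulation: `d ≥ k x / 128`
    have hdk : (k : ℝ) * x / 128 ≤ d := by
      by_contra hlt
      push Not at hlt
      have he := Real.exp_one_lt_d9
      have he0 : 0 < Real.exp 1 := Real.exp_pos 1
      -- `e(d+k)/k < e·(33/128)·x`
      have h1 : Real.exp 1 * (d + k) / k < Real.exp 1 * (33 / 128 * x) := by
        rw [div_lt_iff₀ hk0]
        have hk_le : (k : ℝ) ≤ x * k / 4 := by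
          have := mul_le_mul_of_nonneg_right hx4 hk0.le; linarith
        have h2 : (d : ℝ) + k < (33 / 128 * x) * k := by linarith
        calc Real.exp 1 * (d + k) < Real.exp 1 * ((33 / 128 * x) * k) := mul_lt_mul_of_pos_left h2 he0
          _ = _ := by ring
      have h1' : 0 ≤ Real.exp 1 * (d + k) / k := by positivity
      -- squares: `(e·33/128)² < 1/2`
      have he' : Real.exp 1 < 68 / 25 := by
        have h := Real.exp_one_lt_d9
        norm_num at h ⊢
        linarith
      have he2 : Real.exp 1 ^ 2 < (68 / 25 : ℝ) ^ 2 := pow_lt_pow_left₀ he' he0.le two_ne_zero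
      have hc : Real.exp 1 ^ 2 * (33 / 128 : ℝ) ^ 2 < 1 / 2 := by
        have h8 : ((68 : ℝ) / 25) ^ 2 * (33 / 128) ^ 2 < 1 / 2 := by norm_num
        have h9 : Real.exp 1 ^ 2 * (33 / 128 : ℝ) ^ 2 < (68 / 25) ^ 2 * (33 / 128) ^ 2 :=
          mul_lt_mul_of_pos_right he2 (by norm_num)
        exact h9.trans h8
      have hsq : (Real.exp 1 * (33 / 128 * x)) ^ 2 < x ^ 2 / 2 := by
        have hx2 : 0 < x ^ 2 := by positivity
        have e1 : (Real.exp 1 * (33 / 128 * x)) ^ 2 = Real.exp 1 ^ 2 * (33 / 128) ^ 2 * x ^ 2 := by ring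
        rw [e1]
        calc Real.exp 1 ^ 2 * (33 / 128) ^ 2 * x ^ 2 < 1 / 2 * x ^ 2 := mul_lt_mul_of_pos_right hc hx2
          _ = x ^ 2 / 2 := by ring
      have h3' : (Real.exp 1 * (d + k) / k) ^ 2 ≤ (Real.exp 1 * (33 / 128 * x)) ^ 2 :=
        pow_le_pow_left₀ h1' h1.le 2
      have h3 : (Real.exp 1 * (d + k) / k) ^ 2 < x ^ 2 / 2 := h3'.trans_lt hsq
      -- raise to the `k`-th power
      have hk_ne : k ≠ 0 := Nat.one_le_iff_ne_zero.mp hk1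
      have h4 : ((Real.exp 1 * (d + k) / k) ^ k) ^ 2 < (x ^ k / 4) ^ 2 := by
        have h5 : ((Real.exp 1 * (d + k) / k) ^ 2) ^ k < (x ^ 2 / 2) ^ k :=
          pow_lt_pow_left₀ h3 (sq_nonneg _) hk_ne
        have h6 : (x ^ 2 / 2) ^ k ≤ (x ^ k / 4) ^ 2 := by
          have e2 : (x ^ 2 / 2) ^ k = (x ^ k) ^ 2 / 2 ^ k := by rw [div_pow]; ring
          have e3 : (x ^ k / 4) ^ 2 = (x ^ k) ^ 2 / 16 := by ring
          rw [e2, e3]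
          have h16 : (16 : ℝ) ≤ 2 ^ k := by
            calc (16 : ℝ) = 2 ^ 4 := by norm_num
              _ ≤ 2 ^ k := pow_le_pow_right₀ (by norm_num) hk4
          exact div_le_div_of_nonneg_left (sq_nonneg _) (by norm_num) h16
        calc ((Real.exp 1 * (d + k) / k) ^ k) ^ 2 = ((Real.exp 1 * (d + k) / k) ^ 2) ^ k := by
              rw [← pow_mul, ← pow_mul, Nat.mul_comm]
          _ < (x ^ 2 / 2) ^ k := h5
          _ ≤ (x ^ k / 4) ^ 2 := h6
      have h7 : (Real.exp 1 * (d + k) / k) ^ k < x ^ k / 4 :=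
        lt_of_pow_lt_pow_left₀ 2 (by positivity) h4
      linarith
    -- `k ≥ 3t/4`, so `k x/128 ≥ (3/2048)(L/lam) x`
    have hk34 : 3 / 4 * t ≤ k := by linarith
    have hk34x : 3 / 4 * t * x ≤ k * x := mul_le_mul_of_nonneg_right hk34 hxpos.le
    have hLt : L / lam = 4 * t := by
      rw [ht]; field_simp
    rw [hLt]
    linarith

/-- **Alon's Theorem 2.1** as printed (`∃` an absolute constant; `1/√n ≤ ε < 1/2`).
[cite: Alon2009, Thm. 2.1 (p02)] -/
theorem Alon2009_thm21 : ∃ c : ℝ, 0 < c ∧ ∀ (n : ℕ) (B : Matrix (Fin n) (Fin n) ℝ) (ε : ℝ),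
    (∀ i, B i i = 1) → (∀ i j, i ≠ j → |B i j| ≤ ε) → 1 / Real.sqrt n ≤ ε → ε < 1 / 2 →
      c * Real.log n / (ε ^ 2 * Real.log (1 / ε)) ≤ B.rank :=
  ⟨3 / 2048, by norm_num, fun _ _ _ hdiag hoff hε1 hε2 => Alon2009_thm21_explicit hdiag hoff hε1 hε2.le⟩

/-- **Alon's Theorem 1.1 / LWdW Theorem 48 with an explicit constant** (`c = 3/8192`): diagonal entries
of modulus `≥ 1/2`, off-diagonal entries of modulus `≤ ε`, `1/(2√n) ≤ ε ≤ 1/4` ⇒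
`rank(B) ≥ (3/8192)·log n/(ε² log(1/ε))` (printed proof: `C = diag(1/b_{ii})`, `CB` has unit
diagonal and off-diagonal entries `≤ 2ε`, same rank; Theorem 2.1).
[cite: Alon2009, Thm. 1.1 (p01, proof p03)] -/
theorem Alon2009_thm11_explicit {n : ℕ} {B : Matrix (Fin n) (Fin n) ℝ} {ε : ℝ}
    (hdiag : ∀ i, 1 / 2 ≤ |B i i|) (hoff : ∀ i j, i ≠ j → |B i j| ≤ ε)
    (hε1 : 1 / (2 * Real.sqrt n) ≤ ε) (hε2 : ε ≤ 1 / 4) :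
    3 / 8192 * Real.log n / (ε ^ 2 * Real.log (1 / ε)) ≤ B.rank := by
  classical
  rcases Nat.eq_zero_or_pos n with hn | hn
  · subst hn; simp
  have hn0 : (0 : ℝ) < n := by exact_mod_cast hn
  have hεpos : 0 < ε := lt_of_lt_of_le (by positivity) hε1
  have hBii : ∀ i, B i i ≠ 0 := fun i h => by have := hdiag i; rw [h, abs_zero] at this; linarith
  -- `C B` with `C = diag(1/b_ii)`
  set C : Matrix (Fin n) (Fin n) ℝ := Matrix.diagonal fun i => 1 / B i i with hC
  have hCB : ∀ i j, (C * B) i j = B i j / B i i := fun i j => by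
    rw [hC, Matrix.diagonal_mul]; ring
  have hdiag' : ∀ i, (C * B) i i = 1 := fun i => by rw [hCB, div_self (hBii i)]
  have hoff' : ∀ i j, i ≠ j → |(C * B) i j| ≤ 2 * ε := fun i j hij => by
    rw [hCB, abs_div, div_le_iff₀ (abs_pos.mpr (hBii i))]
    have h1 := hoff i j hij
    have h2 := hdiag i
    nlinarith [abs_nonneg (B i j)]
  have hrank : (C * B).rank = B.rank := by
    refine Matrix.rank_mul_eq_right_of_isUnit_det C B ?_
    rw [hC, Matrix.det_diagonal]
    exact isUnit_iff_ne_zero.mpr (Finset.prod_ne_zero_iff.mpr fun i _ => by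
      rw [one_div]; exact inv_ne_zero (hBii i))
  have hε1' : 1 / Real.sqrt n ≤ 2 * ε := by
    have hs : 0 < Real.sqrt n := Real.sqrt_pos.mpr hn0
    rw [div_le_iff₀ hs]
    rw [div_le_iff₀ (by positivity)] at hε1
    linarith
  have h := Alon2009_thm21_explicit hdiag' hoff' hε1' (by linarith)
  rw [hrank] at h
  -- compare the two bounds
  have hL0 : 0 ≤ Real.log n := Real.log_nonneg (by exact_mod_cast hn)
  have hlam2 : 0 < Real.log (1 / (2 * ε)) := Real.log_pos (by rw [lt_div_iff₀ (by positivity)]; linarith)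
  have hlam : Real.log (1 / (2 * ε)) ≤ Real.log (1 / ε) :=
    Real.log_le_log (by positivity) (by
      rw [div_le_div_iff_of_pos_left (by norm_num) (by positivity) hεpos]; linarith)
  calc 3 / 8192 * Real.log n / (ε ^ 2 * Real.log (1 / ε))
      ≤ 3 / 8192 * Real.log n / (ε ^ 2 * Real.log (1 / (2 * ε))) := by
        apply div_le_div_of_nonneg_left (by positivity) (by positivity)
        exact mul_le_mul_of_nonneg_left hlam (by positivity)
    _ = 3 / 2048 * Real.log n / ((2 * ε) ^ 2 * Real.log (1 / (2 * ε))) := by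
        field_simp
        ring
    _ ≤ B.rank := h

/-- **Alon's Theorem 1.1** as printed (`b_{ii} ≥ 1/2`, `1/(2√n) ≤ ε < 1/4`).
[cite: Alon2009, Thm. 1.1 (p01)] -/
theorem Alon2009_thm11 : ∃ c : ℝ, 0 < c ∧ ∀ (n : ℕ) (B : Matrix (Fin n) (Fin n) ℝ) (ε : ℝ),
    (∀ i, 1 / 2 ≤ B i i) → (∀ i j, i ≠ j → |B i j| ≤ ε) → 1 / (2 * Real.sqrt n) ≤ ε → ε < 1 / 4 →
      c * Real.log n / (ε ^ 2 * Real.log (1 / ε)) ≤ B.rank :=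
  ⟨3 / 8192, by norm_num, fun _ _ _ hdiag hoff hε1 hε2 =>
    Alon2009_thm11_explicit (fun i => (hdiag i).trans (le_abs_self _)) hoff hε1 hε2.le⟩

/-- **LWdW Theorem 48** (p14, "[Alo09]": `|a(i,i)| ≥ 1/2`, `|a(i,j)| ≤ ε`, `1/(2√n) ≤ ε ≤ 1/4` ⇒
`rank(A) ≥ c log n/(ε² log(1/ε))`), in the printed `∃ c > 0` form.
[cite: LeeWeiDeWolf2017, Thm. 48 (p14)] -/
theorem LeeWeiDeWolf2017_thm48 : ∃ c : ℝ, 0 < c ∧ ∀ (n : ℕ) (A : Matrix (Fin n) (Fin n) ℝ) (ε : ℝ),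
    (∀ i, 1 / 2 ≤ |A i i|) → (∀ i j, i ≠ j → |A i j| ≤ ε) → 1 / (2 * Real.sqrt n) ≤ ε → ε ≤ 1 / 4 →
      c * Real.log n / (ε ^ 2 * Real.log (1 / ε)) ≤ A.rank :=
  ⟨3 / 8192, by norm_num, fun _ _ _ hdiag hoff hε1 hε2 => Alon2009_thm11_explicit hdiag hoff hε1 hε2⟩

/-- **LWdW Theorem 49 with an explicit constant**: under the hypotheses of Theorem 48, every COMPLEX
psd factorization of `A` has size `r ≥ √(3/8192)·√(log n)/(ε √(log(1/ε)))` (Theorem 48 and Fact 4,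
`rank(A) ≤ rank_psd(A)²`, the tree's `HasComplexPsdFactorization.rank_le_sq`).
[cite: LeeWeiDeWolf2017, Thm. 49 (p14)] -/
theorem LeeWeiDeWolf2017_thm49_explicit {n r : ℕ} {A : Matrix (Fin n) (Fin n) ℝ} {ε : ℝ}
    (hdiag : ∀ i, 1 / 2 ≤ |A i i|) (hoff : ∀ i j, i ≠ j → |A i j| ≤ ε)
    (hε1 : 1 / (2 * Real.sqrt n) ≤ ε) (hε2 : ε ≤ 1 / 4) (hA : HasComplexPsdFactorization A r) :
    Real.sqrt (3 / 8192) * Real.sqrt (Real.log n) / (ε * Real.sqrt (Real.log (1 / ε))) ≤ r := by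
  rcases Nat.eq_zero_or_pos n with hn | hn
  · subst hn; simp
  have hn0 : (0 : ℝ) < n := by exact_mod_cast hn
  have hεpos : 0 < ε := lt_of_lt_of_le (by positivity) hε1
  have hL0 : 0 ≤ Real.log n := Real.log_nonneg (by exact_mod_cast hn)
  have hlam : 0 < Real.log (1 / ε) := Real.log_pos (by rw [lt_div_iff₀ hεpos]; linarith)
  have h48 := Alon2009_thm11_explicit hdiag hoff hε1 hε2
  have h4 : (A.rank : ℝ) ≤ (r : ℝ) ^ 2 := by exact_mod_cast hA.rank_le_sq
  have hsq : (Real.sqrt (3 / 8192) * Real.sqrt (Real.log n) / (ε * Real.sqrt (Real.log (1 / ε)))) ^ 2 =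
      3 / 8192 * Real.log n / (ε ^ 2 * Real.log (1 / ε)) := by
    rw [div_pow, mul_pow, mul_pow, Real.sq_sqrt (by norm_num), Real.sq_sqrt hL0, Real.sq_sqrt hlam.le]
  refine le_of_pow_le_pow_left₀ two_ne_zero (Nat.cast_nonneg r) ?_
  rw [hsq]
  exact h48.trans h4

/-- **LWdW Theorem 49** as printed (`∃` an absolute constant): under the hypotheses of Theorem 48,
`rank_psd(A) ≥ c√(log n)/(ε√(log(1/ε)))` for the complex psd rank.
[cite: LeeWeiDeWolf2017, Thm. 49 (p14)] -/
theorem LeeWeiDeWolf2017_thm49 : ∃ c : ℝ, 0 < c ∧ ∀ (n r : ℕ) (A : Matrix (Fin n) (Fin n) ℝ) (ε : ℝ),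
    (∀ i, 1 / 2 ≤ |A i i|) → (∀ i j, i ≠ j → |A i j| ≤ ε) → 1 / (2 * Real.sqrt n) ≤ ε → ε ≤ 1 / 4 →
      HasComplexPsdFactorization A r → c * Real.sqrt (Real.log n) / (ε * Real.sqrt (Real.log (1 / ε))) ≤ r :=
  ⟨Real.sqrt (3 / 8192), Real.sqrt_pos.mpr (by norm_num), fun _ _ _ _ hdiag hoff hε1 hε2 hA =>
    LeeWeiDeWolf2017_thm49_explicit hdiag hoff hε1 hε2 hA⟩

/-! ### Lemma 2.3, second statement: the rank of a Hadamard power -/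

/-- Rank factorization through `ℝ^r` of a real matrix of rank `≤ r` (columns in a basis of the
column span, padded with zeros). [folklore] -/
private theorem exists_biFactorization_of_rank_le'' {ι κ : Type*} [Fintype ι] [Fintype κ] (M : Matrix ι κ ℝ) {r : ℕ}
    (hr : M.rank ≤ r) :
    ∃ (a : ι → Fin r → ℝ) (b : κ → Fin r → ℝ), ∀ i j, M i j = ∑ l, a i l * b j l := by
  classical
  let W : Submodule ℝ (ι → ℝ) := Submodule.span ℝ (Set.range M.col)
  let d := Module.finrank ℝ W
  have hd : d = M.rank := (rank_eq_finrank_span_cols M).symm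
  let bW := Module.finBasis ℝ W
  have hmem : ∀ j, M.col j ∈ W := fun j => Submodule.subset_span ⟨j, rfl⟩
  have hdr : d ≤ r := hd ▸ hr
  let a : ι → Fin r → ℝ := fun i l => if h : (l : ℕ) < d then ((bW ⟨l, h⟩ : W) : ι → ℝ) i else 0
  let b : κ → Fin r → ℝ := fun j l => if h : (l : ℕ) < d then bW.repr ⟨M.col j, hmem j⟩ ⟨l, h⟩ else 0
  refine ⟨a, b, fun i j => ?_⟩
  have hcol : (M.col j : ι → ℝ) = ∑ l : Fin d, bW.repr ⟨M.col j, hmem j⟩ l • ((bW l : W) : ι → ℝ) := by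
    have h := bW.sum_repr ⟨M.col j, hmem j⟩
    have h' := congrArg (fun w : W => (w : ι → ℝ)) h
    simp only [Submodule.coe_sum, Submodule.coe_smul] at h'
    exact h'.symm
  have hij : M i j = ∑ l : Fin d, bW.repr ⟨M.col j, hmem j⟩ l * ((bW l : W) : ι → ℝ) i := by
    have := congrFun hcol i
    simp only [Matrix.col_apply, Finset.sum_apply, Pi.smul_apply, smul_eq_mul] at this
    exact this
  rw [hij]
  let emb : Fin d ↪ Fin r := ⟨Fin.castLE hdr, Fin.castLE_injective hdr⟩
  have hsplit : ∑ l : Fin r, a i l * b j l = ∑ l ∈ (univ : Finset (Fin d)).map emb, a i l * b j l := by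
    symm
    refine sum_subset (subset_univ _) fun l _ hl => ?_
    have hl' : ¬ (l : ℕ) < d := by
      intro hlt
      exact hl (Finset.mem_map.mpr ⟨⟨l, hlt⟩, mem_univ _, Fin.ext rfl⟩)
    simp [a, hl']
  rw [hsplit, sum_map]
  refine sum_congr rfl fun l _ => ?_
  have hl : ((emb l : Fin r) : ℕ) < d := by simp [emb]
  have hlfin : (⟨((emb l : Fin r) : ℕ), hl⟩ : Fin d) = l := Fin.ext (by simp [emb])
  simp only [a, b, hl, dif_pos, hlfin]
  ring

/-- Hadamard powers: if `A_{ij} = Σ_{l<r} a_{il} b_{jl}` then `c · A^{∘m}` factors through the multisets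
of size `m` from `r` symbols (`(Σ_l a_l b_l)^m = Σ_f Π_p a_{f(p)} b_{f(p)}`, grouped by the multiset of
`f`), so `rank(c · A^{∘m}) ≤ C(r+m−1, m)` (Barvinok's symmetric-tensor count).
[folklore] -/
private theorem rank_hadamardPow_le' {ι κ : Type*} [Fintype ι] [Fintype κ] {r : ℕ} (A : Matrix ι κ ℝ) (a : ι → Fin r → ℝ)
    (b : κ → Fin r → ℝ) (hab : ∀ i j, A i j = ∑ l, a i l * b j l) (c : ℝ) (m : ℕ) :
    (Matrix.of fun i j => c * A i j ^ m).rank ≤ (r + m - 1).choose m := by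
  classical
  let μ : (Fin m → Fin r) → Sym (Fin r) m := fun f =>
    ⟨(univ : Finset (Fin m)).val.map f, by simp⟩
  let U : Matrix ι (Sym (Fin r) m) ℝ := fun i s =>
    c * (((univ : Finset (Fin m → Fin r)).filter (fun f => μ f = s)).card * (s.1.map (a i)).prod)
  let V : Matrix (Sym (Fin r) m) κ ℝ := fun s j => (s.1.map (b j)).prod
  have hfac : (Matrix.of fun i j => c * A i j ^ m) = U * V := by
    ext i j
    rw [of_apply, hab i j, Matrix.mul_apply]
    have hpow : (∑ l, a i l * b j l) ^ m = ∏ _p : Fin m, ∑ l, a i l * b j l := by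
      rw [prod_const, card_univ, Fintype.card_fin]
    rw [hpow, Finset.prod_univ_sum, Fintype.piFinset_univ, ← Finset.sum_fiberwise univ μ, mul_sum]
    refine sum_congr rfl fun s _ => ?_
    have hconst : ∀ f ∈ univ.filter (fun f => μ f = s),
        ∏ p, a i (f p) * b j (f p) = (s.1.map (a i)).prod * (s.1.map (b j)).prod := by
      intro f hf
      have hs : (univ : Finset (Fin m)).val.map f = s.1 := congrArg Subtype.val (mem_filter.mp hf).2
      rw [prod_mul_distrib, Finset.prod_eq_multiset_prod, Finset.prod_eq_multiset_prod, ← hs,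
        Multiset.map_map, Multiset.map_map]
      rfl
    rw [Finset.sum_congr rfl hconst, Finset.sum_const, nsmul_eq_mul]
    simp only [U, V]
    ring
  calc (Matrix.of fun i j => c * A i j ^ m).rank = (U * V).rank := by rw [hfac]
    _ ≤ U.rank := Matrix.rank_mul_le_left _ _
    _ ≤ Fintype.card (Sym (Fin r) m) := Matrix.rank_le_card_width _
    _ = (r + m - 1).choose m := by
        rw [Sym.card_sym_eq_multichoose, Fintype.card_fin, Nat.multichoose_eq]

/-- **Alon's Lemma 2.3, second statement** (p02, verbatim: "Let `B = (b_{i,j})` be an `n` by `n` matrix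
of rank `d`, and let `P(x)` be an arbitrary polynomial of degree `k`. Then the rank of the `n` by `n`
matrix `(P(b_{i,j}))` is at most `C(k+d, k)`. Moreover, if `P(x) = x^k` then the rank of `(P(b_{i,j}))` is
at most `C(k+d−1, k)`"; proof: the products `v_1^{k_1} ⋯ v_d^{k_d}`, `Σ k_i = k`, of a basis of the row
space span the rows): for any real matrix (any shape), `rank((b_{ij}^k)) ≤ C(k + rank B − 1, k)`. The
first statement is the tree's Barvinok bound `FawziEtAl2015_lemma54_holds`.
[cite: Alon2009, Lemma 2.3 (p02–p03)] -/
theorem Alon2009_lemma23_hadamardPow {ι κ : Type*} [Fintype ι] [Fintype κ] (B : Matrix ι κ ℝ) (k : ℕ) :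
    (Matrix.of fun i j => B i j ^ k).rank ≤ (k + B.rank - 1).choose k := by
  obtain ⟨a, b, hab⟩ := exists_biFactorization_of_rank_le'' B le_rfl
  have h := rank_hadamardPow_le' B a b hab 1 k
  simp only [one_mul] at h
  rwa [Nat.add_comm] at h

end Alon

end Literature.Combinatorics.Optimization
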